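import Summits.AnomalousDissipation.AnomalousDissipation.Theorems.MarginalStabilityChainStrainedLayerLawSumRuleLine
import Summits.AnomalousDissipation.AnomalousDissipation.Theorems.MarginalStabilityChainStretchedVortexRowsStubHardyWirtingerEven
import Literature.Analysis.FluidPDE.StretchedLayerSliceCalculus

/-!
# Stub `stub_vorticityUniformBounds` (crux stmt-AnomalousDissipation-3007, line `strain-work-sum-rule`) — tools B:
# the periodic Poincaré–Wirtinger inequality on one period, mean-subtracted and slice forms

Support file (`--supports stmt-AnomalousDissipation-3007`; registered sub-goal `stub_vorticityUniformBounds_wirtinger`).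
The a-priori chain behind the stub (enstrophy step: `∫∫v² ≤ (L/2π)²∫∫vₓ²` since `∫₀ᴸ v dx ≡ 0`) and the neighbouring
slice-kinematics stub (`stub_excessEnergyKinematic`: Wirtinger in `x` for `u − ū` and for `v`) both use the sharp
one-dimensional periodic Poincaré–Wirtinger inequality on one period. The tree already holds the zero-mean interval form
`wirtinger_periodic` (`∫ₐᵇ g² ≤ ((b − a)/2π)² ∫ₐᵇ g′²` for `g ∈ C¹`, `g a = g b`, `∫ₐᵇ g = 0`; Parseval on `(a, b]`,
file `…StretchedVortexRowsStubHardyWirtingerEven`); this file derives the forms the line consumes: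

* `stub_vorticityUniformBounds_wirtinger_sub_mean`: `∫ₐᵇ (g − ḡ)² ≤ ((b − a)/2π)² ∫ₐᵇ g′²`, `ḡ = (b − a)⁻¹∫ₐᵇ g`
  (interval integrals; apply the zero-mean form to `g − ḡ`);
* `stub_vorticityUniformBounds_wirtinger` (registered): the same on the period cell `(0, L]` as SET integrals
  `∫ x in Ioc 0 L`, the format of the line's functionals;
* `stub_vorticityUniformBounds_wirtinger_slice` / `…_slice_zeroMean`: for a `C¹` plane field `g x y`, `L`-periodic in
  `x`, on every line `y = const`, with the slice derivative `dX g` of `StretchedLayerNS`.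

References: G. H. Hardy, J. E. Littlewood, G. Pólya, *Inequalities*, Thm. 258. All `[folklore]`.
-/

-- `Summit.<Summit>.<Problem>` is the tree's mandated summit-side namespace (CONVENTIONS §2); for this
-- single-conjunct summit the two coincide, so the duplicate is deliberate.
set_option linter.dupNamespace false

noncomputable section

open scoped Topology ENNReal
open Filter Set Function MeasureTheory

namespace Summit.AnomalousDissipation.AnomalousDissipation.Theorems.StrainedLayerLaw.StrainWorkSumRule

open Literature.Analysis.FluidPDE Literature.Analysis.FluidPDE.StretchedLayer
open Summit.AnomalousDissipation.AnomalousDissipation.Theorems.MarginalStabilityChainStretchedVortexRows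

/-! ## Mean-subtracted Wirtinger on an interval -/

/-- **Poincaré–Wirtinger, mean-subtracted interval form.** For `g ∈ C¹(ℝ)` with `g a = g b` (`a < b`):
`∫ₐᵇ (g − ḡ)² ≤ ((b − a)/2π)² ∫ₐᵇ g′²`, `ḡ = (∫ₐᵇ g)/(b − a)` (the zero-mean form applied to `g − ḡ`, whose
derivative is `g′`). [folklore] -/
theorem stub_vorticityUniformBounds_wirtinger_sub_mean {g : ℝ → ℝ} (hg : ContDiff ℝ 1 g) {a b : ℝ}
    (hab : a < b) (hper : g a = g b) :
    ∫ x in a..b, (g x - (∫ s in a..b, g s) / (b - a)) ^ 2 ≤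
      ((b - a) / (2 * Real.pi)) ^ 2 * ∫ x in a..b, deriv g x ^ 2 := by
  set c : ℝ := (∫ s in a..b, g s) / (b - a) with hc
  have hba : b - a ≠ 0 := (sub_pos.2 hab).ne'
  have hh : ContDiff ℝ 1 (fun x => g x - c) := hg.sub contDiff_const
  have hhper : (fun x => g x - c) a = (fun x => g x - c) b := by simp only [hper]
  have hmean : ∫ x in a..b, (fun x => g x - c) x = 0 := by
    have hgi : IntervalIntegrable g volume a b := hg.continuous.intervalIntegrable _ _
    simp only
    rw [intervalIntegral.integral_sub hgi intervalIntegrable_const, intervalIntegral.integral_const, hc,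
      smul_eq_mul]
    field_simp
    ring
  have key := wirtinger_periodic hh hab hhper hmean
  have hderiv : (fun x => deriv (fun x => g x - c) x) = fun x => deriv g x := by
    funext x
    exact deriv_sub_const c
  simp only [hderiv] at key
  exact key

/-! ## The period-cell form (registered sub-goal) -/

/-- **Poincaré–Wirtinger on one period (registered sub-goal `stub_vorticityUniformBounds_wirtinger`).** For
`f ∈ C¹(ℝ)` with `f 0 = f L` (`L > 0`; e.g. `f` `L`-periodic):
`∫_{(0,L]} (f − f̄)² ≤ (L/2π)² ∫_{(0,L]} f′²`, `f̄ = L⁻¹∫_{(0,L]} f`, as set integrals over `Ioc 0 L`. [folklore] -/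
theorem stub_vorticityUniformBounds_wirtinger : ∀ (L : ℝ) (f : ℝ → ℝ), 0 < L → ContDiff ℝ 1 f → f 0 = f L →
    (∫ x in Ioc 0 L, (f x - (∫ s in Ioc 0 L, f s) / L) ^ 2) ≤
      (L / (2 * Real.pi)) ^ 2 * ∫ x in Ioc 0 L, deriv f x ^ 2 := by
  intro L f hL hf hper
  have key := stub_vorticityUniformBounds_wirtinger_sub_mean hf hL hper
  simp only [sub_zero, intervalIntegral.integral_of_le hL.le] at key
  exact key

/-- Zero-mean special case on one period: `∫_{(0,L]} f = 0` ⇒ `∫_{(0,L]} f² ≤ (L/2π)² ∫_{(0,L]} f′²`. [folklore] -/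
theorem stub_vorticityUniformBounds_wirtinger_zeroMean {L : ℝ} {f : ℝ → ℝ} (hL : 0 < L) (hf : ContDiff ℝ 1 f)
    (hper : f 0 = f L) (h0 : ∫ s in Ioc 0 L, f s = 0) :
    (∫ x in Ioc 0 L, f x ^ 2) ≤ (L / (2 * Real.pi)) ^ 2 * ∫ x in Ioc 0 L, deriv f x ^ 2 := by
  have key := stub_vorticityUniformBounds_wirtinger L f hL hf hper
  simp only [h0, zero_div, sub_zero] at key
  exact key

/-! ## Slice forms for plane fields -/

/-- The `x`-slices `s ↦ g s y` of a `C¹` plane field are `C¹`. [folklore] -/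
theorem stub_vorticityUniformBounds_contDiff_slice_x {g : ℝ → ℝ → ℝ} {n : WithTop ℕ∞}
    (hg : ContDiff ℝ n (fun q : ℝ × ℝ => g q.1 q.2)) (y : ℝ) : ContDiff ℝ n (fun s => g s y) :=
  hg.comp (contDiff_id.prodMk contDiff_const)

/-- **Wirtinger on the lines `y = const` of a periodic plane field.** For `g ∈ C¹(ℝ²)` (curried `g x y`),
`L`-periodic in `x` (`L > 0`), and every `y`:
`∫_{(0,L]} (g(·,y) − ḡ(y))² dx ≤ (L/2π)² ∫_{(0,L]} (∂ₓg)(·,y)² dx`, `ḡ(y) = L⁻¹∫_{(0,L]} g(x,y) dx`, with the slice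
derivative `dX g` (Mathlib `deriv` of the slice). [folklore] -/
theorem stub_vorticityUniformBounds_wirtinger_slice {L : ℝ} (hL : 0 < L) {g : ℝ → ℝ → ℝ}
    (hg : ContDiff ℝ 1 (fun q : ℝ × ℝ => g q.1 q.2)) (hper : ∀ x y, g (x + L) y = g x y) (y : ℝ) :
    (∫ x in Ioc 0 L, (g x y - (∫ s in Ioc 0 L, g s y) / L) ^ 2) ≤
      (L / (2 * Real.pi)) ^ 2 * ∫ x in Ioc 0 L, dX g x y ^ 2 := by
  have h0L : (fun s => g s y) 0 = (fun s => g s y) L := by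
    have := hper 0 y
    rw [zero_add] at this
    exact this.symm
  exact stub_vorticityUniformBounds_wirtinger L (fun s => g s y) hL
    (stub_vorticityUniformBounds_contDiff_slice_x hg y) h0L

/-- Zero-mean slice form: if moreover `∫_{(0,L]} g(x,y) dx = 0` on the line `y`, then
`∫_{(0,L]} g(·,y)² ≤ (L/2π)² ∫_{(0,L]} (∂ₓg)(·,y)²` (the case of `v`, whose `x`-mean vanishes identically for a
divergence-free periodic slice with `v → 0`). [folklore] -/
theorem stub_vorticityUniformBounds_wirtinger_slice_zeroMean {L : ℝ} (hL : 0 < L) {g : ℝ → ℝ → ℝ}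
    (hg : ContDiff ℝ 1 (fun q : ℝ × ℝ => g q.1 q.2)) (hper : ∀ x y, g (x + L) y = g x y) {y : ℝ}
    (h0 : ∫ s in Ioc 0 L, g s y = 0) :
    (∫ x in Ioc 0 L, g x y ^ 2) ≤ (L / (2 * Real.pi)) ^ 2 * ∫ x in Ioc 0 L, dX g x y ^ 2 := by
  have key := stub_vorticityUniformBounds_wirtinger_slice hL hg hper y
  simp only [h0, zero_div, sub_zero] at key
  exact key

end Summit.AnomalousDissipation.AnomalousDissipation.Theorems.StrainedLayerLaw.StrainWorkSumRule

end
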